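import Mathlib.NumberTheory.Padics.PadicVal.Basic
import Literature.NumberTheory.EllipticCurves.Curve24A1Descent
import Literature.NumberTheory.EllipticCurves.TwoDescentRankBounds
import Literature.NumberTheory.EllipticCurves.MordellWeilRankZeroProofs
import HarnessLib

/-!
# The curve `21A1 = X₀(21)` has rank `0`: the complete `2`-descent over `ℚ`, carried out

Sibling of `Literature.NumberTheory.EllipticCurves.Curve24A1Descent` (same method, same tools).
Cremona's curve `21A1 = [1, 0, 0, -4, -1] : y² + xy = x³ - 4x - 1` (a model of the modular curve
`X₀(21)`, conductor `21`, `Δ = 3⁴·7²`) has `r = 0` and `|T| = 8` (Cremona, *Algorithms for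
Modular Elliptic Curves*, Table 1, `N = 21`, curve `A1`). This file PROVES the first half of that
table entry, **`r = 0`**, in the form

* `Literature.NumberTheory.EllipticCurves.Curve21A1.finite_point : Finite (21A1)(ℚ)`,

by the complete `2`-descent of Silverman, *AEC*, Prop. X.1.4 / Example X.1.5, on the split
integral model `E' : Y² = X³ + X² - 64X - 64 = (X + 1)(X - 8)(X + 8)` (`X = 4x`,
`Y = 8y + 4x`; the map `(x, y) ↦ (4x, 8y + 4x)` is an injection `21A1(ℚ) → E'(ℚ)`, so finiteness
transfers), using only proved material of the tree: the `2`-descent homomorphism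
`δ = (X - e₁, X - e₂) : E'(ℚ) → ℚˣ/ℚˣ² × ℚˣ/ℚˣ²` with kernel `2E'(ℚ)` (`TwoDescent.lean`), the
Mordell–Weil theorem (`WeierstrassCurve.module_finite_point_holds`) and the counting lemma
`2^(r+2) ≤ #δ(E'(ℚ))` (`pow_finrank_add_two_le_natCard_range`, `TwoDescentRankBounds.lean`),
together with the valuation lemmas of `Curve24A1Descent.lean` (`even_padicValRat_sub`,
`exists_abs_eq_sq_or`).

## The descent (all proved here; `e₁ = -1, e₂ = 8, e₃ = -8`, `S = {2, 3, 7, ∞}`)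

For a rational point `(X, Y)` of `E'` with `Y ≠ 0`, write `A = X + 1`, `B = X - 8`, `C = X + 8`
(`ABC = Y²`, `A - B = 9`, `C - A = 7`, `C - B = 16`):
1. `ord_p A` is even for `p ∉ {3, 7}`, `ord_p B` is even for `p ∉ {2, 3}`, `ord_3 C` is even
   (`even_padicValRat_sub`), hence `ord_3 A ≡ ord_3 B (mod 2)`;
2. so either `|A| ∈ {u², 7u²}` and `|B| ∈ {v², 2v²}`, or `|A| ∈ {3u², 21u²}` and
   `|B| ∈ {3v², 6v²}` (`exists_abs_eq_sq_or_of_even`, `exists_abs_eq_mul_sq_or_of_odd`);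
3. `C > 0` and `A`, `B` have the same sign (`Y² = ABC > 0`);
4. of the sixteen remaining classes, twelve are excluded by a local obstruction on the
   corresponding homogeneous space, in the elementary form of an infinite descent modulo `p = 3`
   or `p = 7` on a single conic `αa² + βb² = pγc²` (`eq_zero_of_sq_descent_rat`, the lemma of
   `Curve24A1Descent` generalised from `3` to a prime `p`) or, for the two classes `(1, 2)` and
   `(-7, -2)` whose three conics are all solvable, modulo `3` on the intersection of two quadrics
   (`sq_descent₂_rat`);
5. so `δ(E'(ℚ)) ⊆ {(1, 1), (-7, -1), (-3, -3), (21, 3)} = δ(torsion)` (`descentPair_mem`), a set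
   of `4 = #E'(ℚ)[2]` classes, whence `2^(r+2) ≤ 4`, `r = 0`, and `E'(ℚ)` is finite by
   Mordell–Weil and the structure theorem (`finite_point_split`, with `T₁ = (-1, 0)` of order `2`
   and `Q = (-4, 12)` of order `4`, `2Q = (8, 0)`, as the two torsion points separated by `δ`).

## References

* [SilvermanAEC2009] J. H. Silverman, *The Arithmetic of Elliptic Curves*, 2nd ed., GTM 106,
  Springer 2009: Prop. X.1.4 (complete `2`-descent) and Example X.1.5; Thm. VIII.6.7.
* [CremonaAlgorithms1997] J. E. Cremona, *Algorithms for Modular Elliptic Curves*, 2nd ed., CUP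
  1997: Table 1, `N = 21`, curve `A1 = [1, 0, 0, -4, -1]`, `r = 0`, `|T| = 8`; §3.6 (descent).
* [Knapp1993] A. W. Knapp, *Elliptic Curves*, Princeton 1992, Thm. 4.2 and §IV.3.

## Design

* Theorems only (no definitions, no notations, no new facts); the two curves are written as
  literal Weierstrass tuples `E' = ⟨0, 1, 0, -64, -64⟩`, `21A1 = ⟨1, 0, 0, -4, -1⟩`.
  Statements about points avoid the group law or are polymorphic in the `DecidableEq ℚ`
  instance; inside proofs the group law is elaborated against the classical instance
  (`letI := Classical.decEq ℚ`), as in `Curve24A1Descent`.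
* Helper lemmas in `namespace Literature.NumberTheory.EllipticCurves.Curve21A1`.
-/

noncomputable section

open WeierstrassCurve WeierstrassCurve.Affine WeierstrassCurve.Affine.Point

namespace Literature.NumberTheory.EllipticCurves

namespace Curve21A1

open Curve24A1 (even_padicValRat_sub exists_abs_eq_sq_or sqClass_mul_sq)

/-! ### Arithmetic of `ℚ`: descents modulo a prime `p`, square classes from valuations -/

/-- **Lifting a congruence modulo `p`**: if the binary form `αa² + βb²` is anisotropic modulo `p`
(hypothesis `H`, decidable for numerical `α, β, p`), then `p ∣ αa² + βb²` forces `p ∣ a` and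
`p ∣ b` (`Curve24A1.three_dvd_of_zmod` for a general modulus). [folklore] -/
theorem natCast_dvd_of_zmod {p : ℕ} {α β : ℤ}
    (H : ∀ a b : ZMod p, (α : ZMod p) * a ^ 2 + (β : ZMod p) * b ^ 2 = 0 → a = 0 ∧ b = 0)
    {a b : ℤ} (h : (p : ℤ) ∣ α * a ^ 2 + β * b ^ 2) : (p : ℤ) ∣ a ∧ (p : ℤ) ∣ b := by
  have h' : (α : ZMod p) * (a : ZMod p) ^ 2 + (β : ZMod p) * (b : ZMod p) ^ 2 = 0 := by
    have := (ZMod.intCast_zmod_eq_zero_iff_dvd _ p).mpr h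
    push_cast at this
    exact this
  obtain ⟨ha, hb⟩ := H _ _ h'
  exact ⟨(ZMod.intCast_zmod_eq_zero_iff_dvd a p).mp ha,
    (ZMod.intCast_zmod_eq_zero_iff_dvd b p).mp hb⟩

/-- **Infinite descent modulo a prime `p`** (the `p`-adic local obstruction of the `2`-descent, in
Fermat's form; `Curve24A1.eq_zero_of_sq_descent` for a general prime): if `αa² + βb²` is
anisotropic modulo `p` and `p ∤ γ`, then the only integer solution of `αa² + βb² = pγc²` is
`a = b = c = 0`. Proof: modulo `p`, `p ∣ a, b`; then `p² ∣ pγc²` gives `p ∣ c`, and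
`(a/p, b/p, c/p)` is a smaller solution. [folklore] -/
theorem eq_zero_of_sq_descent {p : ℕ} (hp : p.Prime) {α β γ : ℤ}
    (H : ∀ a b : ZMod p, (α : ZMod p) * a ^ 2 + (β : ZMod p) * b ^ 2 = 0 → a = 0 ∧ b = 0)
    (hγ : ¬(p : ℤ) ∣ γ) {a b c : ℤ} (h : α * a ^ 2 + β * b ^ 2 = p * γ * c ^ 2) :
    a = 0 ∧ b = 0 ∧ c = 0 := by
  have hP : Prime (p : ℤ) := Nat.prime_iff_prime_int.mp hp
  have hp0 : (p : ℤ) ≠ 0 := hP.ne_zero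
  have hp2 : 2 ≤ p := hp.two_le
  suffices key : ∀ (n : ℕ) (a b c : ℤ), a.natAbs + b.natAbs + c.natAbs ≤ n →
      α * a ^ 2 + β * b ^ 2 = p * γ * c ^ 2 → a = 0 ∧ b = 0 ∧ c = 0 from
    key _ a b c le_rfl h
  intro n
  induction n with
  | zero =>
    intro a b c hn _
    omega
  | succ n ih =>
    intro a b c hn h
    obtain ⟨⟨a', rfl⟩, ⟨b', rfl⟩⟩ :=
      natCast_dvd_of_zmod H (a := a) (b := b) ⟨γ * c ^ 2, by rw [h]; ring⟩
    have h3 : γ * c ^ 2 = p * (α * a' ^ 2 + β * b' ^ 2) := by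
      have : (p : ℤ) * (γ * c ^ 2) = p * (p * (α * a' ^ 2 + β * b' ^ 2)) := by
        linear_combination h.symm
      exact mul_left_cancel₀ hp0 this
    have hpc : (p : ℤ) ∣ c := by
      have h9 : (p : ℤ) ∣ γ * c ^ 2 := ⟨_, h3⟩
      rcases hP.dvd_or_dvd h9 with h' | h'
      · exact absurd h' hγ
      · exact hP.dvd_of_dvd_pow h'
    obtain ⟨c', rfl⟩ := hpc
    have h' : α * a' ^ 2 + β * b' ^ 2 = p * γ * c' ^ 2 := by
      have : (p : ℤ) * (α * a' ^ 2 + β * b' ^ 2) = p * (p * γ * c' ^ 2) := by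
        linear_combination h3.symm
      exact mul_left_cancel₀ hp0 this
    by_cases h0 : a' = 0 ∧ b' = 0 ∧ c' = 0
    · obtain ⟨rfl, rfl, rfl⟩ := h0
      simp
    · simp only [Int.natAbs_mul, Int.natAbs_natCast] at hn
      have ha := Nat.mul_le_mul_right a'.natAbs hp2
      have hb := Nat.mul_le_mul_right b'.natAbs hp2
      have hc := Nat.mul_le_mul_right c'.natAbs hp2
      exact absurd (ih a' b' c' (by omega) h') h0

/-- **The rational form of the descent modulo `p`**: under the same hypotheses,
`αa² + βb² = pγc²` has no rational solution other than `a = b = c = 0` (clear denominators).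
[folklore] -/
theorem eq_zero_of_sq_descent_rat {p : ℕ} (hp : p.Prime) {α β γ : ℤ}
    (H : ∀ a b : ZMod p, (α : ZMod p) * a ^ 2 + (β : ZMod p) * b ^ 2 = 0 → a = 0 ∧ b = 0)
    (hγ : ¬(p : ℤ) ∣ γ) {a b c : ℚ} (h : (α : ℚ) * a ^ 2 + β * b ^ 2 = p * γ * c ^ 2) :
    a = 0 ∧ b = 0 ∧ c = 0 := by
  set D : ℚ := (a.den : ℚ) * b.den * c.den with hD
  have hD0 : D ≠ 0 := by rw [hD]; positivity
  have ha : a * D = ((a.num * b.den * c.den : ℤ) : ℚ) := by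
    push_cast; rw [hD, ← Rat.mul_den_eq_num a]; ring
  have hb : b * D = ((b.num * a.den * c.den : ℤ) : ℚ) := by
    push_cast; rw [hD, ← Rat.mul_den_eq_num b]; ring
  have hc : c * D = ((c.num * a.den * b.den : ℤ) : ℚ) := by
    push_cast; rw [hD, ← Rat.mul_den_eq_num c]; ring
  have key : (α : ℚ) * (a * D) ^ 2 + β * (b * D) ^ 2 = p * γ * (c * D) ^ 2 := by
    linear_combination D ^ 2 * h
  rw [ha, hb, hc] at key
  have key' : α * (a.num * b.den * c.den) ^ 2 + β * (b.num * a.den * c.den) ^ 2 =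
      p * γ * (c.num * a.den * b.den) ^ 2 := by
    exact_mod_cast key
  obtain ⟨h1, h2, h3⟩ := eq_zero_of_sq_descent hp H hγ key'
  refine ⟨?_, ?_, ?_⟩
  · have : a * D = 0 := by rw [ha, h1, Int.cast_zero]
    exact (mul_eq_zero.mp this).resolve_right hD0
  · have : b * D = 0 := by rw [hb, h2, Int.cast_zero]
    exact (mul_eq_zero.mp this).resolve_right hD0
  · have : c * D = 0 := by rw [hc, h3, Int.cast_zero]
    exact (mul_eq_zero.mp this).resolve_right hD0

/-- **Infinite descent modulo `p` on an intersection of two quadrics**: if the pair of diagonal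
forms `αa² + βb² + γc²`, `δd² + εa² + ζc²` has no common non-trivial zero modulo `p` (hypothesis
`H`, decidable for numerical data), then it has no common non-trivial integer zero (all of
`a, b, c, d` are divisible by `p`, and dividing by `p` gives a smaller zero). This is the
`p`-adic obstruction on a homogeneous space of the `2`-descent that is invisible on each of its
three conics separately. [folklore] -/
theorem eq_zero_of_sq_descent₂ {p : ℕ} (hp : p.Prime) {α β γ δ ε ζ : ℤ}
    (H : ∀ a b c d : ZMod p,
      (α : ZMod p) * a ^ 2 + (β : ZMod p) * b ^ 2 + (γ : ZMod p) * c ^ 2 = 0 →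
      (δ : ZMod p) * d ^ 2 + (ε : ZMod p) * a ^ 2 + (ζ : ZMod p) * c ^ 2 = 0 →
        a = 0 ∧ b = 0 ∧ c = 0 ∧ d = 0)
    {a b c d : ℤ} (h₁ : α * a ^ 2 + β * b ^ 2 + γ * c ^ 2 = 0)
    (h₂ : δ * d ^ 2 + ε * a ^ 2 + ζ * c ^ 2 = 0) : a = 0 ∧ b = 0 ∧ c = 0 ∧ d = 0 := by
  have hp0 : (p : ℤ) ≠ 0 := by exact_mod_cast hp.ne_zero
  have hp2 : 2 ≤ p := hp.two_le
  suffices key : ∀ (n : ℕ) (a b c d : ℤ), a.natAbs + b.natAbs + c.natAbs + d.natAbs ≤ n →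
      α * a ^ 2 + β * b ^ 2 + γ * c ^ 2 = 0 → δ * d ^ 2 + ε * a ^ 2 + ζ * c ^ 2 = 0 →
        a = 0 ∧ b = 0 ∧ c = 0 ∧ d = 0 from key _ a b c d le_rfl h₁ h₂
  intro n
  induction n with
  | zero =>
    intro a b c d hn _ _
    omega
  | succ n ih =>
    intro a b c d hn h₁ h₂
    have hdvd : ∀ z : ℤ, (z : ZMod p) = 0 → (p : ℤ) ∣ z := fun z hz =>
      (ZMod.intCast_zmod_eq_zero_iff_dvd z p).mp hz
    have h₁' : (α : ZMod p) * (a : ZMod p) ^ 2 + (β : ZMod p) * (b : ZMod p) ^ 2 +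
        (γ : ZMod p) * (c : ZMod p) ^ 2 = 0 := by
      have := congrArg (Int.cast : ℤ → ZMod p) h₁
      push_cast at this
      exact this
    have h₂' : (δ : ZMod p) * (d : ZMod p) ^ 2 + (ε : ZMod p) * (a : ZMod p) ^ 2 +
        (ζ : ZMod p) * (c : ZMod p) ^ 2 = 0 := by
      have := congrArg (Int.cast : ℤ → ZMod p) h₂
      push_cast at this
      exact this
    obtain ⟨ha, hb, hc, hd⟩ := H _ _ _ _ h₁' h₂'
    obtain ⟨a', rfl⟩ := hdvd a ha
    obtain ⟨b', rfl⟩ := hdvd b hb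
    obtain ⟨c', rfl⟩ := hdvd c hc
    obtain ⟨d', rfl⟩ := hdvd d hd
    have hp2ne : (p : ℤ) ^ 2 ≠ 0 := pow_ne_zero 2 hp0
    have h₁'' : α * a' ^ 2 + β * b' ^ 2 + γ * c' ^ 2 = 0 := by
      have : (p : ℤ) ^ 2 * (α * a' ^ 2 + β * b' ^ 2 + γ * c' ^ 2) = 0 := by
        linear_combination h₁
      exact (mul_eq_zero.mp this).resolve_left hp2ne
    have h₂'' : δ * d' ^ 2 + ε * a' ^ 2 + ζ * c' ^ 2 = 0 := by
      have : (p : ℤ) ^ 2 * (δ * d' ^ 2 + ε * a' ^ 2 + ζ * c' ^ 2) = 0 := by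
        linear_combination h₂
      exact (mul_eq_zero.mp this).resolve_left hp2ne
    by_cases h0 : a' = 0 ∧ b' = 0 ∧ c' = 0 ∧ d' = 0
    · obtain ⟨rfl, rfl, rfl, rfl⟩ := h0
      simp
    · simp only [Int.natAbs_mul, Int.natAbs_natCast] at hn
      have ha := Nat.mul_le_mul_right a'.natAbs hp2
      have hb := Nat.mul_le_mul_right b'.natAbs hp2
      have hc := Nat.mul_le_mul_right c'.natAbs hp2
      have hd := Nat.mul_le_mul_right d'.natAbs hp2
      exact absurd (ih a' b' c' d' (by omega) h₁'' h₂'') h0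

/-- **The rational form of the descent on two quadrics**: under the same hypothesis, the affine
system `αu² + βv² + γ = 0`, `δw² + εu² + ζ = 0` has no rational solution (clear denominators;
the constant terms carry `c = 1`). [folklore] -/
theorem sq_descent₂_rat {p : ℕ} (hp : p.Prime) {α β γ δ ε ζ : ℤ}
    (H : ∀ a b c d : ZMod p,
      (α : ZMod p) * a ^ 2 + (β : ZMod p) * b ^ 2 + (γ : ZMod p) * c ^ 2 = 0 →
      (δ : ZMod p) * d ^ 2 + (ε : ZMod p) * a ^ 2 + (ζ : ZMod p) * c ^ 2 = 0 →
        a = 0 ∧ b = 0 ∧ c = 0 ∧ d = 0)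
    {u v w : ℚ} (h₁ : (α : ℚ) * u ^ 2 + β * v ^ 2 + γ = 0)
    (h₂ : (δ : ℚ) * w ^ 2 + ε * u ^ 2 + ζ = 0) : False := by
  set D : ℚ := (u.den : ℚ) * v.den * w.den with hD
  have hu : u * D = ((u.num * v.den * w.den : ℤ) : ℚ) := by
    push_cast; rw [hD, ← Rat.mul_den_eq_num u]; ring
  have hv : v * D = ((v.num * u.den * w.den : ℤ) : ℚ) := by
    push_cast; rw [hD, ← Rat.mul_den_eq_num v]; ring
  have hw : w * D = ((w.num * u.den * v.den : ℤ) : ℚ) := by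
    push_cast; rw [hD, ← Rat.mul_den_eq_num w]; ring
  have hD' : D = (((u.den : ℤ) * v.den * w.den : ℤ) : ℚ) := by push_cast; rw [hD]
  have key₁ : (α : ℚ) * (u * D) ^ 2 + β * (v * D) ^ 2 + γ * D ^ 2 = 0 := by
    linear_combination D ^ 2 * h₁
  have key₂ : (δ : ℚ) * (w * D) ^ 2 + ε * (u * D) ^ 2 + ζ * D ^ 2 = 0 := by
    linear_combination D ^ 2 * h₂
  rw [hu, hv, hD'] at key₁
  rw [hw, hu, hD'] at key₂
  have key₁' : α * (u.num * v.den * w.den) ^ 2 + β * (v.num * u.den * w.den) ^ 2 +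
      γ * ((u.den : ℤ) * v.den * w.den) ^ 2 = 0 := by
    exact_mod_cast key₁
  have key₂' : δ * (w.num * u.den * v.den) ^ 2 + ε * (u.num * v.den * w.den) ^ 2 +
      ζ * ((u.den : ℤ) * v.den * w.den) ^ 2 = 0 := by
    exact_mod_cast key₂
  obtain ⟨-, -, h0, -⟩ := eq_zero_of_sq_descent₂ hp H key₁' key₂'
  have hpos : (0 : ℤ) < u.den * v.den * w.den := by positivity
  exact hpos.ne' h0

/-- **Square class from valuations, even case**: if `ord_p(r)` is even for every prime
`p ∉ {q₁, q₂}` and also `ord_{q₁}(r)` is even, then `|r| = u²` or `|r| = q₂u²` (Silverman,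
*AEC*, Example X.1.5: `b ∈ ℚ(S, 2)` is represented by `±∏_{p ∈ S} p^{ε_p}`). [folklore] -/
theorem exists_abs_eq_sq_or_of_even {r : ℚ} (hr : r ≠ 0) (q₁ q₂ : ℕ) (hq₂ : q₂.Prime)
    (h : ∀ p : ℕ, p.Prime → p ≠ q₁ → p ≠ q₂ → Even (padicValRat p r))
    (hev : Even (padicValRat q₁ r)) : ∃ u : ℚ, |r| = u ^ 2 ∨ |r| = q₂ * u ^ 2 :=
  haveI := Fact.mk hq₂
  exists_abs_eq_sq_or hr q₂ fun p hp hp₂ => by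
    by_cases hp₁ : p = q₁
    · subst hp₁
      exact hev
    · exact h p hp hp₁ hp₂

/-- **Square class from valuations, odd case**: if `ord_p(r)` is even for every prime
`p ∉ {q₁, q₂}` and `ord_{q₁}(r)` is odd, then `|r| = q₁u²` or `|r| = q₁q₂u²` (apply the even
case to `r/q₁`). [folklore] -/
theorem exists_abs_eq_mul_sq_or_of_odd {r : ℚ} (hr : r ≠ 0) (q₁ q₂ : ℕ) (hq₁ : q₁.Prime)
    (hq₂ : q₂.Prime) (h : ∀ p : ℕ, p.Prime → p ≠ q₁ → p ≠ q₂ → Even (padicValRat p r))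
    (hodd : Odd (padicValRat q₁ r)) :
    ∃ u : ℚ, |r| = q₁ * u ^ 2 ∨ |r| = q₁ * q₂ * u ^ 2 := by
  haveI := Fact.mk hq₁
  haveI := Fact.mk hq₂
  have hq0 : (q₁ : ℚ) ≠ 0 := Nat.cast_ne_zero.mpr hq₁.ne_zero
  obtain ⟨u, hu⟩ := exists_abs_eq_sq_or (div_ne_zero hr hq0) q₂ fun p hp hp₂ => by
    haveI := Fact.mk hp
    rw [padicValRat.div hr hq0, padicValRat.of_nat]
    by_cases hp₁ : p = q₁
    · subst hp₁
      rw [padicValNat_self, Nat.cast_one]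
      obtain ⟨k, hk⟩ := hodd
      exact ⟨k, by omega⟩
    · rw [padicValNat_primes hp₁, Nat.cast_zero, sub_zero]
      exact h p hp hp₁ hp₂
  rw [abs_div, Nat.abs_cast] at hu
  refine ⟨u, ?_⟩
  rcases hu with hu | hu
  · left
    rw [div_eq_iff hq0] at hu
    rw [hu]
    ring
  · right
    rw [div_eq_iff hq0] at hu
    rw [hu]
    ring

/-- `3` is not the square of a rational number (`ord₃ 3 = 1` is odd). [folklore] -/
theorem three_ne_sq (u : ℚ) : (3 : ℚ) ≠ u ^ 2 := by
  intro h
  have key := congrArg (padicValRat 3) h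
  rw [padicValRat.pow, show (3 : ℚ) = ((3 : ℕ) : ℚ) by norm_num, padicValRat.of_nat,
    padicValNat_self] at key
  omega

/-! ### The split integral model `E' = [0, 1, 0, -64, -64]` of `21A1` and its `2`-descent -/

/-- The affine equation of the split model: `Y² = X³ + X² - 64X - 64`.
[cite: CremonaAlgorithms1997, Table 1, N = 21, curve A1] -/
theorem equation_split_iff (x y : ℚ) :
    (⟨0, 1, 0, -64, -64⟩ : WeierstrassCurve ℚ).toAffine.Equation x y ↔
      y ^ 2 = x ^ 3 + x ^ 2 - 64 * x - 64 := by
  rw [Affine.equation_iff]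
  dsimp only
  constructor <;> intro h <;> linear_combination h

/-- `Δ(E') = 16257024 = 2¹²·3⁴·7²` (`= 4096 · Δ(21A1)`, `Δ(21A1) = 3969 = 3⁴·7²`: Cremona,
Table 1, `N = 21`, curve `A1`). [cite: CremonaAlgorithms1997, Table 1, N = 21, curve A1] -/
theorem split_Δ : (⟨0, 1, 0, -64, -64⟩ : WeierstrassCurve ℚ).Δ = 16257024 := by
  norm_num [WeierstrassCurve.Δ, b₂, b₄, b₆, b₈]

/-- The split model is an elliptic curve (`Δ ≠ 0`).
[cite: CremonaAlgorithms1997, Table 1, N = 21, curve A1] -/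
theorem isElliptic_split : (⟨0, 1, 0, -64, -64⟩ : WeierstrassCurve ℚ).IsElliptic :=
  ⟨by rw [split_Δ]; norm_num⟩

/-- `E' : Y² = X³ + X² - 64X - 64` has rational `2`-torsion with `e₁ = -1, e₂ = 8, e₃ = -8`
(`b₂ = 4 = -4Σeᵢ`, `b₄ = -128 = 2Σeᵢeⱼ`, `b₆ = -256 = -4e₁e₂e₃`), the hypothesis
`SplitTwoTorsion` of the tree's complete `2`-descent (Cremona, Table 1, `21A1`: `|T| = 8`, so
`E[2] ⊆ E(ℚ)`). [cite: CremonaAlgorithms1997, Table 1, N = 21, curve A1] -/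
theorem splitTwoTorsion :
    (⟨0, 1, 0, -64, -64⟩ : WeierstrassCurve ℚ).toAffine.SplitTwoTorsion (-1) 8 (-8) := by
  refine ⟨?_, ?_, ?_⟩ <;> norm_num [b₂, b₄, b₆]

/-- On `E'`, `Y² = (X - (-1))(X - 8)(X - (-8))`.
[cite: CremonaAlgorithms1997, Table 1, N = 21, curve A1] -/
theorem sq_eq_of_equation {x y : ℚ}
    (h : (⟨0, 1, 0, -64, -64⟩ : WeierstrassCurve ℚ).toAffine.Equation x y) :
    y ^ 2 = (x - (-1)) * (x - 8) * (x - (-8)) := by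
  rw [equation_split_iff] at h
  linear_combination h

/-- An affine point of `E'` with `Y = 0` is one of the three `2`-torsion points
`X ∈ {-1, 8, -8}`. [cite: CremonaAlgorithms1997, Table 1, N = 21, curve A1] -/
theorem x_eq_of_y_eq_zero {x y : ℚ}
    (h : (⟨0, 1, 0, -64, -64⟩ : WeierstrassCurve ℚ).toAffine.Equation x y) (hy : y = 0) :
    x = -1 ∨ x = 8 ∨ x = -8 := by
  have hE := sq_eq_of_equation h
  rw [hy, zero_pow two_ne_zero, zero_eq_mul, mul_eq_zero] at hE
  rcases hE with (hE | hE) | hE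
  · exact Or.inl (by linarith)
  · exact Or.inr (Or.inl (by linarith))
  · exact Or.inr (Or.inr (by linarith))

/-- **The `2`-descent on `E'`, arithmetic core** (Silverman, *AEC*, Example X.1.5 carried out for
`Y² = (X + 1)(X - 8)(X + 8)`, `S = {2, 3, 7, ∞}`): for a rational point `(X, Y)` with `Y ≠ 0`
there are non-zero rationals `u, v` with
`(X + 1, X - 8) ∈ {(u², v²), (-7u², -v²), (-3u², -3v²), (21u², 3v²)}`.
Proof: items 1–4 of the module docstring — parities of valuations (`even_padicValRat_sub`),
`ord₃(X + 1) ≡ ord₃(X - 8) (mod 2)` from `ord₃(X + 8)` even, signs from `Y² > 0`, and twelve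
local obstructions: modulo `7` on `v² + 9 = 7u²`, `2v² + 9 = 7u²`, `w² + u² = 7`, `2w² + u² = 7`,
`v² - 3 = 7u²`, `w² - 3u² = 7`; modulo `3` on `2v² - u² = 3`, `2v² - 7u² = 3`, `u² - 2v² = 3`,
`7u² - 2v² = 3`; and modulo `3` on the quadric intersections
`{u² - 2v² = 9, 2w² - u² = 7}`, `{-7u² + 2v² = 9, 2w² + u² = 1}` (here `X + 8 = d₃w²` with
`w = kY/(uv)`). [cite: SilvermanAEC2009, Example X.1.5 (method)] -/
theorem exists_eq_mul_sq_of_equation {x y : ℚ}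
    (h : (⟨0, 1, 0, -64, -64⟩ : WeierstrassCurve ℚ).toAffine.Equation x y) (hy : y ≠ 0) :
    ∃ u v : ℚ, u ≠ 0 ∧ v ≠ 0 ∧
      ((x - (-1) = u ^ 2 ∧ x - 8 = v ^ 2) ∨ (x - (-1) = -7 * u ^ 2 ∧ x - 8 = -v ^ 2) ∨
        (x - (-1) = -3 * u ^ 2 ∧ x - 8 = -3 * v ^ 2) ∨
        (x - (-1) = 21 * u ^ 2 ∧ x - 8 = 3 * v ^ 2)) := by
  have hE := sq_eq_of_equation h
  have hE₂ : y ^ 2 = (x - 8) * (x - (-1)) * (x - (-8)) := by rw [hE]; ring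
  have hE₃ : y ^ 2 = (x - (-8)) * (x - (-1)) * (x - 8) := by rw [hE]; ring
  have h₀ : (x - (-1)) * (x - 8) * (x - (-8)) ≠ 0 := hE ▸ pow_ne_zero 2 hy
  have hA : x - (-1) ≠ 0 := fun h0 => h₀ (by rw [h0, zero_mul, zero_mul])
  have hB : x - 8 ≠ 0 := fun h0 => h₀ (by rw [h0, mul_zero, zero_mul])
  have hC : x - (-8) ≠ 0 := fun h0 => h₀ (by rw [h0, mul_zero])
  -- parities of valuations
  have PA : ∀ p : ℕ, p.Prime → p ≠ 3 → p ≠ 7 → Even (padicValRat p (x - (-1))) :=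
      fun p hp hp3 hp7 => by
    haveI := Fact.mk hp
    haveI : Fact (Nat.Prime 7) := ⟨Nat.prime_seven⟩
    refine even_padicValRat_sub p (by norm_num) (by norm_num) ?_ ?_ hy hE
    · rw [show (-1 : ℚ) - 8 = -(((3 : ℕ) : ℚ) ^ 2) by norm_num, padicValRat.neg,
        padicValRat.pow, padicValRat.of_nat, padicValNat_primes hp3, Nat.cast_zero, mul_zero]
    · rw [show (-1 : ℚ) - (-8) = ((7 : ℕ) : ℚ) by norm_num, padicValRat.of_nat,
        padicValNat_primes hp7, Nat.cast_zero]
  have PB : ∀ p : ℕ, p.Prime → p ≠ 3 → p ≠ 2 → Even (padicValRat p (x - 8)) :=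
      fun p hp hp3 hp2 => by
    haveI := Fact.mk hp
    refine even_padicValRat_sub p (by norm_num) (by norm_num) ?_ ?_ hy hE₂
    · rw [show (8 : ℚ) - (-1) = ((3 : ℕ) : ℚ) ^ 2 by norm_num, padicValRat.pow,
        padicValRat.of_nat, padicValNat_primes hp3, Nat.cast_zero, mul_zero]
    · rw [show (8 : ℚ) - (-8) = ((2 : ℕ) : ℚ) ^ 4 by norm_num, padicValRat.pow,
        padicValRat.of_nat, padicValNat_primes hp2, Nat.cast_zero, mul_zero]
  have PC : Even (padicValRat 3 (x - (-8))) := by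
    haveI : Fact (Nat.Prime 7) := ⟨Nat.prime_seven⟩
    refine even_padicValRat_sub 3 (by norm_num) (by norm_num) ?_ ?_ hy hE₃
    · rw [show (-8 : ℚ) - (-1) = -((7 : ℕ) : ℚ) by norm_num, padicValRat.neg,
        padicValRat.of_nat, padicValNat_primes (by norm_num), Nat.cast_zero]
    · rw [show (-8 : ℚ) - 8 = -(((2 : ℕ) : ℚ) ^ 4) by norm_num, padicValRat.neg,
        padicValRat.pow, padicValRat.of_nat, padicValNat_primes (by norm_num), Nat.cast_zero,
        mul_zero]
  have hsum : 2 * padicValRat 3 y =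
      padicValRat 3 (x - (-1)) + padicValRat 3 (x - 8) + padicValRat 3 (x - (-8)) := by
    have key := congrArg (padicValRat 3) hE
    rw [padicValRat.pow, padicValRat.mul (mul_ne_zero hA hB) hC, padicValRat.mul hA hB] at key
    exact_mod_cast key
  -- signs: `x + 8 > 0` and `x + 1`, `x - 8` have the same sign
  have hy2 : 0 < (x - (-1)) * (x - 8) * (x - (-8)) := by rw [← hE]; positivity
  have hsign : 0 < (x - (-1)) * (x - 8) := by
    by_contra hle
    push Not at hle
    rcases le_or_gt (x - (-8)) 0 with h3 | h3
    · have h1 : x - (-1) < 0 := by linarith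
      have h2 : x - 8 < 0 := by linarith
      nlinarith [mul_pos_of_neg_of_neg h1 h2]
    · nlinarith
  -- anisotropy modulo `3` and `7` of the binary forms that occur
  have H3a : ∀ a b : ZMod 3, ((2 : ℤ) : ZMod 3) * a ^ 2 + ((-1 : ℤ) : ZMod 3) * b ^ 2 = 0 →
      a = 0 ∧ b = 0 := by decide
  have H3b : ∀ a b : ZMod 3, ((2 : ℤ) : ZMod 3) * a ^ 2 + ((-7 : ℤ) : ZMod 3) * b ^ 2 = 0 →
      a = 0 ∧ b = 0 := by decide
  have H3c : ∀ a b : ZMod 3, ((1 : ℤ) : ZMod 3) * a ^ 2 + ((-2 : ℤ) : ZMod 3) * b ^ 2 = 0 →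
      a = 0 ∧ b = 0 := by decide
  have H3d : ∀ a b : ZMod 3, ((7 : ℤ) : ZMod 3) * a ^ 2 + ((-2 : ℤ) : ZMod 3) * b ^ 2 = 0 →
      a = 0 ∧ b = 0 := by decide
  have H7a : ∀ a b : ZMod 7, ((1 : ℤ) : ZMod 7) * a ^ 2 + ((9 : ℤ) : ZMod 7) * b ^ 2 = 0 →
      a = 0 ∧ b = 0 := by decide
  have H7b : ∀ a b : ZMod 7, ((2 : ℤ) : ZMod 7) * a ^ 2 + ((9 : ℤ) : ZMod 7) * b ^ 2 = 0 →
      a = 0 ∧ b = 0 := by decide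
  have H7c : ∀ a b : ZMod 7, ((1 : ℤ) : ZMod 7) * a ^ 2 + ((1 : ℤ) : ZMod 7) * b ^ 2 = 0 →
      a = 0 ∧ b = 0 := by decide
  have H7d : ∀ a b : ZMod 7, ((2 : ℤ) : ZMod 7) * a ^ 2 + ((1 : ℤ) : ZMod 7) * b ^ 2 = 0 →
      a = 0 ∧ b = 0 := by decide
  have H7e : ∀ a b : ZMod 7, ((1 : ℤ) : ZMod 7) * a ^ 2 + ((-3 : ℤ) : ZMod 7) * b ^ 2 = 0 →
      a = 0 ∧ b = 0 := by decide
  have HS1 : ∀ a b c d : ZMod 3, ((1 : ℤ) : ZMod 3) * a ^ 2 + ((-2 : ℤ) : ZMod 3) * b ^ 2 +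
      ((-9 : ℤ) : ZMod 3) * c ^ 2 = 0 → ((2 : ℤ) : ZMod 3) * d ^ 2 + ((-1 : ℤ) : ZMod 3) * a ^ 2 +
      ((-7 : ℤ) : ZMod 3) * c ^ 2 = 0 → a = 0 ∧ b = 0 ∧ c = 0 ∧ d = 0 := by decide
  have HS2 : ∀ a b c d : ZMod 3, ((-7 : ℤ) : ZMod 3) * a ^ 2 + ((2 : ℤ) : ZMod 3) * b ^ 2 +
      ((-9 : ℤ) : ZMod 3) * c ^ 2 = 0 → ((2 : ℤ) : ZMod 3) * d ^ 2 + ((1 : ℤ) : ZMod 3) * a ^ 2 +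
      ((-1 : ℤ) : ZMod 3) * c ^ 2 = 0 → a = 0 ∧ b = 0 ∧ c = 0 ∧ d = 0 := by decide
  have hγ3 : ¬((3 : ℕ) : ℤ) ∣ 1 := by decide
  have hγ7 : ¬((7 : ℕ) : ℤ) ∣ 1 := by decide
  rcases Int.even_or_odd (padicValRat 3 (x - (-1))) with hev | hodd
  · -- `ord₃(x + 1)` even, hence `ord₃(x - 8)` even: `|x + 1| ∈ {u², 7u²}`, `|x - 8| ∈ {v², 2v²}`
    have hevB : Even (padicValRat 3 (x - 8)) := by
      obtain ⟨a, ha⟩ := hev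
      obtain ⟨c, hc⟩ := PC
      exact ⟨padicValRat 3 y - a - c, by omega⟩
    obtain ⟨u, hu⟩ := exists_abs_eq_sq_or_of_even hA 3 7 Nat.prime_seven PA hev
    obtain ⟨v, hv⟩ := exists_abs_eq_sq_or_of_even hB 3 2 Nat.prime_two PB hevB
    push_cast at hu hv
    have hu0 : u ≠ 0 := by
      rintro rfl
      have : |x - (-1)| = 0 := by rcases hu with hu | hu <;> rw [hu] <;> ring
      exact hA (abs_eq_zero.mp this)
    have hv0 : v ≠ 0 := by
      rintro rfl
      have : |x - 8| = 0 := by rcases hv with hv | hv <;> rw [hv] <;> ring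
      exact hB (abs_eq_zero.mp this)
    rcases lt_or_gt_of_ne hA with hneg | hpos
    · -- `x + 1 < 0`, hence `x - 8 < 0`
      have hneg₂ : x - 8 < 0 := by linarith
      rw [abs_of_neg hneg] at hu
      rw [abs_of_neg hneg₂] at hv
      rcases hu with hu | hu <;> rcases hv with hv | hv
      · -- `(-1, -1)`: `x + 8 = w²`, `w² + u² = 7`, obstruction modulo `7`
        exfalso
        have hy' : y ^ 2 = u ^ 2 * v ^ 2 * (x - (-8)) := by
          rw [hE, show x - (-1) = -u ^ 2 by linarith, show x - 8 = -v ^ 2 by linarith]; ring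
        have hw : x - (-8) = (y / (u * v)) ^ 2 := by
          field_simp
          linear_combination -hy'
        have key := eq_zero_of_sq_descent_rat Nat.prime_seven H7c hγ7 (a := y / (u * v)) (b := u)
          (c := 1) (by push_cast; linarith)
        exact one_ne_zero key.2.2
      · -- `(-1, -2)`: `x + 8 = 2w²`, `2w² + u² = 7`, obstruction modulo `7`
        exfalso
        have hy' : y ^ 2 = 2 * u ^ 2 * v ^ 2 * (x - (-8)) := by
          rw [hE, show x - (-1) = -u ^ 2 by linarith, show x - 8 = -(2 * v ^ 2) by linarith]
          ring
        have hw : x - (-8) = 2 * (y / (2 * u * v)) ^ 2 := by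
          field_simp
          linear_combination -hy'
        have key := eq_zero_of_sq_descent_rat Nat.prime_seven H7d hγ7 (a := y / (2 * u * v))
          (b := u) (c := 1) (by push_cast; linarith)
        exact one_ne_zero key.2.2
      · -- `(-7, -1)`
        exact ⟨u, v, hu0, hv0, Or.inr (Or.inl ⟨by linarith, by linarith⟩)⟩
      · -- `(-7, -2)`: `x + 8 = 14w²`; `{-7u² + 2v² = 9, 2w² + u² = 1}`, obstruction modulo `3`
        exfalso
        have hy' : y ^ 2 = 14 * u ^ 2 * v ^ 2 * (x - (-8)) := by
          rw [hE, show x - (-1) = -(7 * u ^ 2) by linarith, show x - 8 = -(2 * v ^ 2) by linarith]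
          ring
        have hw : x - (-8) = 14 * (y / (14 * u * v)) ^ 2 := by
          field_simp
          linear_combination -hy'
        exact sq_descent₂_rat Nat.prime_three HS2 (u := u) (v := v) (w := y / (14 * u * v))
          (by push_cast; linarith) (by push_cast; linarith)
    · -- `x + 1 > 0`, hence `x - 8 > 0`
      have hpos₂ : 0 < x - 8 := by
        by_contra hh
        push Not at hh
        nlinarith
      rw [abs_of_pos hpos] at hu
      rw [abs_of_pos hpos₂] at hv
      rcases hu with hu | hu <;> rcases hv with hv | hv
      · -- `(1, 1)`
        exact ⟨u, v, hu0, hv0, Or.inl ⟨hu, hv⟩⟩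
      · -- `(1, 2)`: `x + 8 = 2w²`; `{u² - 2v² = 9, 2w² - u² = 7}`, obstruction modulo `3`
        exfalso
        have hy' : y ^ 2 = 2 * u ^ 2 * v ^ 2 * (x - (-8)) := by rw [hE, hu, hv]; ring
        have hw : x - (-8) = 2 * (y / (2 * u * v)) ^ 2 := by
          field_simp
          linear_combination -hy'
        exact sq_descent₂_rat Nat.prime_three HS1 (u := u) (v := v) (w := y / (2 * u * v))
          (by push_cast; linarith) (by push_cast; linarith)
      · -- `(7, 1)`: `v² + 9 = 7u²`, obstruction modulo `7`
        exfalso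
        have key := eq_zero_of_sq_descent_rat Nat.prime_seven H7a hγ7 (a := v) (b := 1) (c := u)
          (by push_cast; linarith)
        exact one_ne_zero key.2.1
      · -- `(7, 2)`: `2v² + 9 = 7u²`, obstruction modulo `7`
        exfalso
        have key := eq_zero_of_sq_descent_rat Nat.prime_seven H7b hγ7 (a := v) (b := 1) (c := u)
          (by push_cast; linarith)
        exact one_ne_zero key.2.1
  · -- `ord₃(x + 1)` odd, hence `ord₃(x - 8)` odd: `|x + 1| ∈ {3u², 21u²}`, `|x - 8| ∈ {3v², 6v²}`
    have hoddB : Odd (padicValRat 3 (x - 8)) := by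
      obtain ⟨a, ha⟩ := hodd
      obtain ⟨c, hc⟩ := PC
      exact ⟨padicValRat 3 y - a - c - 1, by omega⟩
    obtain ⟨u, hu⟩ := exists_abs_eq_mul_sq_or_of_odd hA 3 7 Nat.prime_three Nat.prime_seven PA hodd
    obtain ⟨v, hv⟩ := exists_abs_eq_mul_sq_or_of_odd hB 3 2 Nat.prime_three Nat.prime_two PB hoddB
    push_cast at hu hv
    have hu0 : u ≠ 0 := by
      rintro rfl
      have : |x - (-1)| = 0 := by rcases hu with hu | hu <;> rw [hu] <;> ring
      exact hA (abs_eq_zero.mp this)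
    have hv0 : v ≠ 0 := by
      rintro rfl
      have : |x - 8| = 0 := by rcases hv with hv | hv <;> rw [hv] <;> ring
      exact hB (abs_eq_zero.mp this)
    rcases lt_or_gt_of_ne hA with hneg | hpos
    · -- `x + 1 < 0`, hence `x - 8 < 0`
      have hneg₂ : x - 8 < 0 := by linarith
      rw [abs_of_neg hneg] at hu
      rw [abs_of_neg hneg₂] at hv
      rcases hu with hu | hu <;> rcases hv with hv | hv
      · -- `(-3, -3)`
        exact ⟨u, v, hu0, hv0, Or.inr (Or.inr (Or.inl ⟨by linarith, by linarith⟩))⟩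
      · -- `(-3, -6)`: `2v² - u² = 3`, obstruction modulo `3`
        exfalso
        have key := eq_zero_of_sq_descent_rat Nat.prime_three H3a hγ3 (a := v) (b := u) (c := 1)
          (by push_cast; linarith)
        exact one_ne_zero key.2.2
      · -- `(-21, -3)`: `v² - 3 = 7u²`, obstruction modulo `7`
        exfalso
        have key := eq_zero_of_sq_descent_rat Nat.prime_seven H7e hγ7 (a := v) (b := 1) (c := u)
          (by push_cast; linarith)
        exact one_ne_zero key.2.1
      · -- `(-21, -6)`: `2v² - 7u² = 3`, obstruction modulo `3`
        exfalso
        have key := eq_zero_of_sq_descent_rat Nat.prime_three H3b hγ3 (a := v) (b := u) (c := 1)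
          (by push_cast; linarith)
        exact one_ne_zero key.2.2
    · -- `x + 1 > 0`, hence `x - 8 > 0`
      have hpos₂ : 0 < x - 8 := by
        by_contra hh
        push Not at hh
        nlinarith
      rw [abs_of_pos hpos] at hu
      rw [abs_of_pos hpos₂] at hv
      rcases hu with hu | hu <;> rcases hv with hv | hv
      · -- `(3, 3)`: `x + 8 = w²`, `w² - 3u² = 7`, obstruction modulo `7`
        exfalso
        have hy' : y ^ 2 = 9 * u ^ 2 * v ^ 2 * (x - (-8)) := by rw [hE, hu, hv]; ring
        have hw : x - (-8) = (y / (3 * u * v)) ^ 2 := by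
          field_simp
          linear_combination -hy'
        have key := eq_zero_of_sq_descent_rat Nat.prime_seven H7e hγ7 (a := y / (3 * u * v))
          (b := u) (c := 1) (by push_cast; linarith)
        exact one_ne_zero key.2.2
      · -- `(3, 6)`: `u² - 2v² = 3`, obstruction modulo `3`
        exfalso
        have key := eq_zero_of_sq_descent_rat Nat.prime_three H3c hγ3 (a := u) (b := v) (c := 1)
          (by push_cast; linarith)
        exact one_ne_zero key.2.2
      · -- `(21, 3)`
        exact ⟨u, v, hu0, hv0, Or.inr (Or.inr (Or.inr ⟨by linarith, by linarith⟩))⟩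
      · -- `(21, 6)`: `7u² - 2v² = 3`, obstruction modulo `3`
        exfalso
        have key := eq_zero_of_sq_descent_rat Nat.prime_three H3d hγ3 (a := u) (b := v) (c := 1)
          (by push_cast; linarith)
        exact one_ne_zero key.2.2

/-- **The image of the complete `2`-descent on `E'`** (Silverman, *AEC*, Prop. X.1.4 and
Example X.1.5): for every rational point `P`, the pair of descent components
`(δ₁(P), δ₂(P)) = (X + 1, X - 8) ∈ ℚˣ/ℚˣ² × ℚˣ/ℚˣ²` (with the conventions at `O, T₁, T₂`) is one
of the four classes `(1, 1), (-7, -1), (-3, -3), (21, 3)` — the images of the torsion points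
`O` and `(8, 0)`, of `(-1, 0)` and `(-8, 0)`, of `(-4, ±12)`, of `(20, ±84)`. Polymorphic in the
`DecidableEq ℚ` argument of the tree's `twoDescentComponent`.
[cite: SilvermanAEC2009, Prop. X.1.4 and Example X.1.5] -/
theorem descentPair_mem [DecidableEq ℚ]
    (P : (⟨0, 1, 0, -64, -64⟩ : WeierstrassCurve ℚ).toAffine.Point) :
    (twoDescentComponent (⟨0, 1, 0, -64, -64⟩ : WeierstrassCurve ℚ).toAffine (-1) 8 (-8) P,
      twoDescentComponent (⟨0, 1, 0, -64, -64⟩ : WeierstrassCurve ℚ).toAffine 8 (-1) (-8) P) ∈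
      ({(1, 1), (sqClass (-7), sqClass (-1)), (sqClass (-3), sqClass (-3)),
        (sqClass 21, sqClass 3)} : Set (SqUnits ℚ × SqUnits ℚ)) := by
  simp only [Set.mem_insert_iff, Set.mem_singleton_iff, Prod.mk.injEq]
  rcases P with _ | ⟨x, y, hP⟩
  · exact Or.inl ⟨rfl, rfl⟩
  · by_cases hx1 : x = -1
    · subst hx1
      refine Or.inr (Or.inl ⟨?_, ?_⟩)
      · rw [twoDescentComponent_some_of_eq hP rfl,
          show ((-1 : ℚ) - 8) * (-1 - (-8)) = -7 * 3 ^ 2 by norm_num,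
          sqClass_mul_sq (by norm_num) (by norm_num)]
      · rw [twoDescentComponent_some_of_ne hP (by norm_num),
          show (-1 : ℚ) - 8 = -1 * 3 ^ 2 by norm_num, sqClass_mul_sq (by norm_num) (by norm_num)]
    by_cases hx2 : x = 8
    · subst hx2
      refine Or.inl ⟨?_, ?_⟩
      · rw [twoDescentComponent_some_of_ne hP (by norm_num),
          show (8 : ℚ) - (-1) = 3 ^ 2 by norm_num, sqClass_sq]
      · rw [twoDescentComponent_some_of_eq hP rfl,
          show ((8 : ℚ) - (-1)) * (8 - (-8)) = 12 ^ 2 by norm_num, sqClass_sq]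
    by_cases hx3 : x = -8
    · subst hx3
      refine Or.inr (Or.inl ⟨?_, ?_⟩)
      · rw [twoDescentComponent_some_of_ne hP (by norm_num)]
        norm_num
      · rw [twoDescentComponent_some_of_ne hP (by norm_num),
          show (-8 : ℚ) - 8 = -1 * 4 ^ 2 by norm_num, sqClass_mul_sq (by norm_num) (by norm_num)]
    have hy : y ≠ 0 := fun hy => by
      rcases x_eq_of_y_eq_zero hP.1 hy with h | h | h
      · exact hx1 h
      · exact hx2 h
      · exact hx3 h
    obtain ⟨u, v, hu, hv, hcases⟩ := exists_eq_mul_sq_of_equation hP.1 hy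
    rw [twoDescentComponent_some_of_ne hP hx1, twoDescentComponent_some_of_ne hP hx2]
    rcases hcases with ⟨h1, h2⟩ | ⟨h1, h2⟩ | ⟨h1, h2⟩ | ⟨h1, h2⟩
    · refine Or.inl ⟨?_, ?_⟩
      · rw [h1, sqClass_sq]
      · rw [h2, sqClass_sq]
    · refine Or.inr (Or.inl ⟨?_, ?_⟩)
      · rw [h1, sqClass_mul_sq (by norm_num) hu]
      · rw [h2, show -v ^ 2 = -1 * v ^ 2 by ring, sqClass_mul_sq (by norm_num) hv]
    · refine Or.inr (Or.inr (Or.inl ⟨?_, ?_⟩))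
      · rw [h1, sqClass_mul_sq (by norm_num) hu]
      · rw [h2, sqClass_mul_sq (by norm_num) hv]
    · refine Or.inr (Or.inr (Or.inr ⟨?_, ?_⟩))
      · rw [h1, sqClass_mul_sq (by norm_num) hu]
      · rw [h2, sqClass_mul_sq (by norm_num) hv]

/-! ### Rank zero: `E'(ℚ)` and `21A1(ℚ)` are finite -/

/-- **`2 · (-4, 12) = (8, 0)` on `E'`** (chord-and-tangent: tangent slope `-1` at `(-4, 12)`),
so that `(-4, ±12)` are points of order `4` (the images of the points `(-1, -1), (-1, 2)` of
order `4` of `21A1`; Cremona, Table 1, `21A1`: `|T| = 8`, `T ≅ ℤ/2ℤ × ℤ/4ℤ`). Polymorphic in the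
`DecidableEq ℚ` instance behind Mathlib's group law.
[cite: CremonaAlgorithms1997, Table 1, N = 21, curve A1] -/
theorem add_self_neg_four [DecidableEq ℚ]
    (hQ : (⟨0, 1, 0, -64, -64⟩ : WeierstrassCurve ℚ).toAffine.Nonsingular (-4) 12)
    (hT : (⟨0, 1, 0, -64, -64⟩ : WeierstrassCurve ℚ).toAffine.Nonsingular 8 0) :
    (Point.some (-4) 12 hQ : (⟨0, 1, 0, -64, -64⟩ : WeierstrassCurve ℚ).toAffine.Point) +
      Point.some (-4) 12 hQ = Point.some 8 0 hT := by
  have hy : (12 : ℚ) ≠ (⟨0, 1, 0, -64, -64⟩ : WeierstrassCurve ℚ).toAffine.negY (-4) 12 := by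
    norm_num [negY]
  rw [add_self_of_Y_ne hy]
  congr 1
  · rw [slope_of_Y_ne rfl hy]
    norm_num [addX, negY]
  · rw [slope_of_Y_ne rfl hy]
    norm_num [addY, negAddY, addX, negY]

/-- **The split model `E'` of `21A1` has Mordell–Weil rank `0`: `E'(ℚ)` is finite** (Cremona,
Table 1, `N = 21`, curve `A1`: `r = 0`), proved by the complete `2`-descent (Silverman, *AEC*,
Prop. X.1.4, Example X.1.5): the `2`-descent map `δ` (tree `twoDescentMap`, kernel `2E'(ℚ)`)
takes at most the `4` values of `descentPair_mem`, while by the counting lemma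
`pow_finrank_add_two_le_natCard_range` (with the torsion points `T₁ = (-1, 0)` and
`Q = (-4, 12)`, `2Q = (8, 0)`, which `δ` separates: `δ(T₁) = (-7, -1)`, `δ(Q) = (-3, -3)`,
`δ(T₁ + Q) = (21, 3)`, none trivial as `-1`, `-3` and `3` are not rational squares) it takes at
least `2^(r + 2)` values, `r = rank_ℤ E'(ℚ)` (Mordell–Weil, tree `module_finite_point_holds`); so
`r = 0` and `E'(ℚ)` is finite (`finite_point_of_mordellWeilRank_eq_zero`).
[cite: CremonaAlgorithms1997, Table 1, N = 21, curve A1 (r = 0)] -/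
theorem finite_point_split : Finite (⟨0, 1, 0, -64, -64⟩ : WeierstrassCurve ℚ).toAffine.Point := by
  letI := Classical.decEq ℚ
  haveI : (⟨0, 1, 0, -64, -64⟩ : WeierstrassCurve ℚ).IsElliptic := isElliptic_split
  haveI : Module.Finite ℤ (⟨0, 1, 0, -64, -64⟩ : WeierstrassCurve ℚ).toAffine.Point :=
    WeierstrassCurve.module_finite_point_holds (W := (⟨0, 1, 0, -64, -64⟩ : WeierstrassCurve ℚ))
  have h := splitTwoTorsion
  set ψ := twoDescentMap h with hψ
  -- the torsion points `T₁ = (-1, 0)`, `Q = (-4, 12)`, `T₂ = (8, 0) = 2Q`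
  have hns : ∀ {a b : ℚ}, (⟨0, 1, 0, -64, -64⟩ : WeierstrassCurve ℚ).toAffine.Equation a b →
      (⟨0, 1, 0, -64, -64⟩ : WeierstrassCurve ℚ).toAffine.Nonsingular a b :=
    fun hab => equation_iff_nonsingular.mp hab
  have hT₁ : (⟨0, 1, 0, -64, -64⟩ : WeierstrassCurve ℚ).toAffine.Nonsingular (-1) 0 :=
    hns ((equation_split_iff (-1) 0).mpr (by norm_num))
  have hT₂ : (⟨0, 1, 0, -64, -64⟩ : WeierstrassCurve ℚ).toAffine.Nonsingular 8 0 :=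
    hns ((equation_split_iff 8 0).mpr (by norm_num))
  have hQ : (⟨0, 1, 0, -64, -64⟩ : WeierstrassCurve ℚ).toAffine.Nonsingular (-4) 12 :=
    hns ((equation_split_iff (-4) 12).mpr (by norm_num))
  set T₁ : (⟨0, 1, 0, -64, -64⟩ : WeierstrassCurve ℚ).toAffine.Point := .some (-1) 0 hT₁ with hT₁def
  set Q : (⟨0, 1, 0, -64, -64⟩ : WeierstrassCurve ℚ).toAffine.Point := .some (-4) 12 hQ with hQdef
  have h18 : (-1 : ℚ) ≠ 8 := by norm_num
  have h41 : (-4 : ℚ) ≠ -1 := by norm_num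
  have h48 : (-4 : ℚ) ≠ 8 := by norm_num
  -- `-9`, `-3` and `3` (hence `108 = 3 · 6²`) are not squares
  have hm9 : sqClass (-9 : ℚ) ≠ 1 := fun h1 => by
    obtain ⟨u, hu⟩ := (sqClass_eq_one_iff (by norm_num)).mp h1
    nlinarith [sq_nonneg u]
  have hm3 : sqClass (-3 : ℚ) ≠ 1 := fun h1 => by
    obtain ⟨u, hu⟩ := (sqClass_eq_one_iff (by norm_num)).mp h1
    nlinarith [sq_nonneg u]
  have h108 : sqClass (108 : ℚ) ≠ 1 := fun h1 => by
    rw [show (108 : ℚ) = 3 * 6 ^ 2 by norm_num, sqClass_mul_sq three_ne_zero (by norm_num)] at h1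
    obtain ⟨u, hu⟩ := (sqClass_eq_one_iff three_ne_zero).mp h1
    exact three_ne_sq u hu
  -- values of `ψ`
  have hψT₁ : ψ T₁ = Additive.ofMul (sqClass ((-1 - 8) * (-1 - (-8))), sqClass (-1 - 8)) := by
    rw [hψ, twoDescentMap_apply, twoDescentComponent_some_of_eq hT₁ rfl,
      twoDescentComponent_some_of_ne hT₁ h18]
  have hψQ : ψ Q = Additive.ofMul (sqClass (-4 - (-1)), sqClass (-4 - 8)) := by
    rw [hψ, twoDescentMap_apply, twoDescentComponent_some_of_ne hQ h41,
      twoDescentComponent_some_of_ne hQ h48]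
  have h₁ : ψ T₁ ≠ 0 := by
    rw [hψT₁, Ne, ofMul_eq_zero, Prod.mk_eq_one, not_and_or]
    exact Or.inr (by norm_num; exact hm9)
  have h₂ : ψ Q ≠ 0 := by
    rw [hψQ, Ne, ofMul_eq_zero, Prod.mk_eq_one, not_and_or]
    exact Or.inl (by norm_num; exact hm3)
  have h₃ : ψ (T₁ + Q) ≠ 0 := by
    rw [map_add, hψT₁, hψQ, ← ofMul_mul, Prod.mk_mul_mk, Ne, ofMul_eq_zero, Prod.mk_eq_one,
      not_and_or]
    refine Or.inr ?_
    rw [← sqClass_mul (by norm_num) (by norm_num)]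
    norm_num
    exact h108
  have h₁₂ : ψ T₁ ≠ ψ Q := by
    rw [hψT₁, hψQ, Ne, Additive.ofMul.apply_eq_iff_eq, Prod.mk.injEq, not_and_or]
    refine Or.inr fun heq => h108 ?_
    have key : sqClass ((-1 : ℚ) - 8) * sqClass (-4 - 8) = 1 := by rw [heq, SqUnits.mul_self]
    rw [← sqClass_mul (by norm_num) (by norm_num)] at key
    norm_num at key
    exact key
  -- the kernel of `ψ` is `2E'(ℚ)`
  have hker : ∀ a, ψ a = 0 → ∃ b, a = 2 • b := fun a ha => by
    have ha' : a ∈ ψ.ker := ha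
    rw [hψ, ker_twoDescentMap h] at ha'
    obtain ⟨b, hb⟩ := ha'
    exact ⟨b, hb.symm⟩
  -- finite order of `T₁` and `Q`
  have hfin₁ : IsOfFinAddOrder T₁ := by
    refine isOfFinAddOrder_iff_nsmul_eq_zero.mpr ⟨2, two_pos, ?_⟩
    rw [two_nsmul, hT₁def]
    exact add_self_of_Y_eq (by norm_num [negY])
  have hfin₂ : IsOfFinAddOrder Q := by
    refine isOfFinAddOrder_iff_nsmul_eq_zero.mpr ⟨4, by norm_num, ?_⟩
    rw [show 4 • Q = 2 • (Q + Q) by rw [← two_nsmul, ← mul_nsmul'], hQdef,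
      add_self_neg_four hQ hT₂, two_nsmul]
    exact add_self_of_Y_eq (by norm_num [negY])
  -- the range of `ψ` has at most `4` elements
  set S : Set (SqUnits ℚ × SqUnits ℚ) := {(1, 1), (sqClass (-7), sqClass (-1)),
    (sqClass (-3), sqClass (-3)), (sqClass 21, sqClass 3)} with hS
  have hSfin : S.Finite := (((Set.finite_singleton _).insert _).insert _).insert _
  have hS4 : S.ncard ≤ 4 := by
    rw [hS]
    refine (Set.ncard_insert_le _ _).trans ?_
    refine (Nat.add_le_add_right (Set.ncard_insert_le _ _) 1).trans ?_
    refine (Nat.add_le_add_right (Nat.add_le_add_right (Set.ncard_insert_le _ _) 1) 1).trans ?_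
    rw [Set.ncard_singleton]
  have hsub : Set.range ψ ⊆ Additive.ofMul '' S := by
    rintro _ ⟨P, rfl⟩
    exact ⟨_, descentPair_mem P, by rw [hψ]; exact (twoDescentMap_apply h P).symm⟩
  have hTfin : (Additive.ofMul '' S).Finite := hSfin.image _
  haveI : Finite ψ.range :=
    (hTfin.subset (by rw [AddMonoidHom.coe_range]; exact hsub)).to_subtype
  have hcard : Nat.card ψ.range ≤ 4 := by
    rw [← SetLike.coe_sort_coe, Nat.card_coe_set_eq, AddMonoidHom.coe_range]
    calc (Set.range ψ).ncard ≤ (Additive.ofMul '' S).ncard := Set.ncard_le_ncard hsub hTfin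
      _ ≤ S.ncard := Set.ncard_image_le hSfin
      _ ≤ 4 := hS4
  -- counting: `2 ^ (r + 2) ≤ 4`
  have hbound := pow_finrank_add_two_le_natCard_range ψ hker hfin₁ hfin₂ h₁ h₂ h₃ h₁₂
  have hr : (⟨0, 1, 0, -64, -64⟩ : WeierstrassCurve ℚ).mordellWeilRank = 0 := by
    have hle :
        2 ^ (Module.finrank ℤ (⟨0, 1, 0, -64, -64⟩ : WeierstrassCurve ℚ).toAffine.Point + 2) ≤
          2 ^ 2 := hbound.trans hcard
    have := (Nat.pow_le_pow_iff_right (by norm_num)).mp hle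
    unfold WeierstrassCurve.mordellWeilRank
    omega
  exact WeierstrassCurve.finite_point_of_mordellWeilRank_eq_zero
    (⟨0, 1, 0, -64, -64⟩ : WeierstrassCurve ℚ) hr

/-- **The change of model `21A1 → E'`, `(x, y) ↦ (4x, 8y + 4x)`** (completing the square in
`21A1 : y² + xy = x³ - 4x - 1`: `16(2y + x)² = 64(y² + xy) + 16x² = (4x)³ + (4x)² - 64(4x) - 64`),
on affine points.
[cite: CremonaAlgorithms1997, Table 1, N = 21, curve A1] -/
theorem nonsingular_split_of_nonsingular {x y : ℚ}
    (h : (⟨1, 0, 0, -4, -1⟩ : WeierstrassCurve ℚ).toAffine.Nonsingular x y) :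
    (⟨0, 1, 0, -64, -64⟩ : WeierstrassCurve ℚ).toAffine.Nonsingular (4 * x) (8 * y + 4 * x) := by
  haveI : (⟨0, 1, 0, -64, -64⟩ : WeierstrassCurve ℚ).IsElliptic := isElliptic_split
  have h1 := h.1
  rw [Affine.equation_iff] at h1
  dsimp only at h1
  exact equation_iff_nonsingular.mp ((equation_split_iff _ _).mpr (by linear_combination 64 * h1))

/-- **`21A1 = X₀(21)` has Mordell–Weil rank `0`: its group of rational points is finite**
(Cremona, *Algorithms for Modular Elliptic Curves*, Table 1, `N = 21`, curve
`A1 = [1, 0, 0, -4, -1]`: `r = 0`). Proof: the change of model `(x, y) ↦ (4x, 8y + 4x)`,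
`O ↦ O` is an injection of `21A1(ℚ)` into `E'(ℚ)`, which is finite by the complete `2`-descent
(`finite_point_split`). [cite: CremonaAlgorithms1997, Table 1, N = 21, curve A1 (r = 0)] -/
theorem finite_point : Finite (⟨1, 0, 0, -4, -1⟩ : WeierstrassCurve ℚ).toAffine.Point := by
  haveI := finite_point_split
  refine Finite.of_injective (β := (⟨0, 1, 0, -64, -64⟩ : WeierstrassCurve ℚ).toAffine.Point)
    (fun P => match P with
      | .zero => .zero
      | .some x y h => .some (4 * x) (8 * y + 4 * x) (nonsingular_split_of_nonsingular h)) ?_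
  rintro (_ | ⟨x₁, y₁, h₁⟩) (_ | ⟨x₂, y₂, h₂⟩) hf <;> dsimp only at hf
  · rfl
  · cases hf
  · cases hf
  · rw [Point.some.injEq] at hf
    obtain ⟨hx, hy⟩ := hf
    have hx' : x₁ = x₂ := by linarith
    subst hx'
    have hy' : y₁ = y₂ := by linarith
    subst hy'
    rfl

end Curve21A1

end Literature.NumberTheory.EllipticCurves

end
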